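import Summits.BirchSwinnertonDyer.BirchSwinnertonDyer.Theorems.ManinLocalTwoThreeBracketSturmEightyFourA
import Summits.BirchSwinnertonDyer.BirchSwinnertonDyer.Theorems.ManinLocalTwoThreeBracketSturmProducts
import Summits.BirchSwinnertonDyer.BirchSwinnertonDyer.Theorems.ManinLocalTwoThreePinningTwoFiftyTwoTablesI
import Summits.BirchSwinnertonDyer.BirchSwinnertonDyer.Theorems.ManinLocalTwoThreePinningKernelCusp
import Literature.NumberTheory.EllipticCurves.NewformsLevelRaising
import HarnessLib

/-!
# The two ROOT FORMS of level 84 as DATUM-FREE TERMS `φ₈₄ₐ, φ₈₄ᵦ ∈ S₂(Γ₀(84))`, their tables to depth `194` and their Néron squeezes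

Cell `bsd-f2-manin`, route `ManinLocalTwoThree` (cruxes C2 `ManinOddAtFour` stmt-BirchSwinnertonDyer-22967 / C3 `ManinPrimeToThreeAtNine` stmt-…-22968;
`--supports`, helper), prover seat p2 gen 32.  PURPOSE: LEVEL `252 = 2²·3²·7` lies in BOTH crux domains and its two classes are `252a = 84a ⊗ χ₋₃`,
`252b = 84b ⊗ χ₋₃` (LEAD-MEMO v44 §8); p3's odd-twist ROOT-FORM transport (`…OddTwistRootFormTransport`, `p = 3`) closes them once the roots
exist as TERMS `f₀ : CuspForm (Gamma0 84) 2` with (i) a certified coefficient table and (ii) the squeeze `Λ(f₀) ⊆ Λ_Néron(84a1/84b1)`.  p2's LEVEL-84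
certificate (`…BracketSturmEightyFourA/B`, gen 31) proves `|c| = 1` for every `X₀(84)`-DATUM; this file re-instantiates it datum-free (pattern of LEAD p1's
`…RootFormsEighty`), computing NO new kernel certificate except two small row identities:
* §1 an's `η`-basis of `M₂(Γ₀(84))` as terms `C84` (`PinningKernel.exists_etaModularForms` + `choose`) with p2's depth-`194` tables (`tabsDeep_eq_coeff`
  from the landed `hcertDeep0…21`); an's CUSPIDAL `η`-basis of `S₂(Γ₀(252))` as terms `S252`/`C252` with an g57's depth-`192` tables (`tabs252_eq_coeff`).
* §2–3 per class: `PhiX := (1/d′)·Σ_j y_j·C84 j` (an's pinning row), `coeff_PhiX : aₙ = cFX[n] (n < 194)`; CUSPIDALITY by the level-`252` device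
  (p1 LEAD-MEMO v44 §5 / p2 `…PhiFortyFourCuspForm`): `2·PhiX|₂₅₂ = Σ_j uX_j·C252 j` in `M₂(Γ₀(252))` by Sturm (`97` coefficients, one `decide` row identity),
  hence `PhiX` is half a level-`252` CUSP form and vanishes at all cusps ⇒ **`phiEightyFourA`, `phiEightyFourB : CuspForm (Gamma0 84) 2`** (terms),
  `tA/tB_eq_cuspCoeff`, `_ne_zero`, and **`periodLattice_le_phiEightyFourA/B`**: `Λ(φ) ⊆ Λ(L₀)` for every Néron pair of `84a1 = [0,1,0,7,0]` /
  `84b1 = [0,−1,0,−1,−2]` (p2's `defectList_eq_eightyFourA/B` fed to `defectForm_coeff_eq_zero_of_defectList` + `periodLattice_le_of_defectForm_eq_zero`).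
HONEST FRAMING: unconditional (standard axioms); bookkeeping for the level-`252` capstone; nothing here proves C2/C3 for any `N`, Manin's conjecture or BSD.
The `List ℤ` `uA/uB` are data certified by `decide`; no `Prop` definition, no named fact, no sorry.
[cite: Sturm1987, Thm. 1] [cite: DiamondShurman2005, §5.6] [cite: CremonaAlgorithms1997, §2.10, Table 1 (84a1, 84b1), Table 3 (N = 84)] [cite: Ligozat1975, Ch. 3]
-/

set_option autoImplicit false
-- lint-debt: the directory name repeats the summit name (sibling precedent `ManinLocalTwoThreeRootFormsEighty.lean`)
set_option linter.dupNamespace false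

noncomputable section

open Complex Filter Topology
open UpperHalfPlane hiding I
open scoped Real Topology Manifold MatrixGroups ModularForm
open ModularForm CongruenceSubgroup PowerSeries
open Literature.NumberTheory.ModularForms
open Literature.NumberTheory.EllipticCurves Literature.NumberTheory.EllipticCurves.ModularForms

namespace Summit.BirchSwinnertonDyer.BirchSwinnertonDyer.Theorems.ManinLocalTwoThree.RootFormsEightyFour

open Summit.BirchSwinnertonDyer.BirchSwinnertonDyer.Theorems.ManinLocalTwoThree
open BracketSturm PinningKernel LevelEightyFour PinningEightyFour

set_option maxHeartbeats 4000000
set_option maxRecDepth 16384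

/-! ## §1 The basis terms of levels `84` and `252` and their certified tables -/

/-- an's `22` holomorphic `η`-quotients of `M₂(Γ₀(84))` (`PinningEightyFour.Ls`, certificate `hol`) as TERMS. [cite: Ligozat1975, Ch. 3] -/
def C84 : Fin 22 → ModularForm (Gamma0 84) 2 := (exists_etaModularForms 84 Ls hol).choose

/-- `C84 i` is the `i`-th `η`-quotient as a function. [folklore] -/
theorem C84_apply : ∀ i, ∀ τ : ℍ, C84 i τ = etaQuotient 84 (expFn (Ls[(i : ℕ)]).1) τ := (exists_etaModularForms 84 Ls hol).choose_spec

/-- p2's depth-`194` kernel certificates of all `22` quotients, collected (landed one per deep file). [cite: Koehler2011, §2.1] -/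
theorem hcertDeep_all : ∀ j : Fin 22, mulList 194 (tabsDeep j) (etaDenList 194 84 (expFn (Ls[(j : ℕ)]).1)) =
    etaNumList 194 84 (expFn (Ls[(j : ℕ)]).1) (shifts j) := by
  intro j; fin_cases j
  exacts [hcertDeep0, hcertDeep1, hcertDeep2, hcertDeep3, hcertDeep4, hcertDeep5, hcertDeep6, hcertDeep7, hcertDeep8, hcertDeep9, hcertDeep10, hcertDeep11, hcertDeep12, hcertDeep13, hcertDeep14, hcertDeep15, hcertDeep16, hcertDeep17, hcertDeep18, hcertDeep19, hcertDeep20, hcertDeep21]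

/-- **`tabsDeep j [n] = aₙ(C84 j)` for `n < 194`.** [cite: Koehler2011, §2.1] -/
theorem tabsDeep_eq_coeff : ∀ j, ∀ n < 194, (((tabsDeep j).getD n 0 : ℤ) : ℂ) = (qExpansion 1 ⇑(C84 j)).coeff n :=
  tables_of_etaCerts 84 194 (fun j : Fin 22 ↦ expFn (Ls[(j : ℕ)]).1) shifts tabsDeep C84 C84_apply hshift hcertDeep_all

/-- an g57's `37` CUSPIDAL `η`-quotients of `S₂(Γ₀(252))` (`PinningTwoFiftyTwo.Ls`, certificate `hcusp`) as TERMS. [cite: Ligozat1975, Ch. 3] -/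
def S252 : Fin 37 → CuspForm (Gamma0 252) 2 := (exists_etaCuspForms 252 PinningTwoFiftyTwo.Ls PinningTwoFiftyTwo.hcusp).choose

/-- `S252 i` is the `i`-th `η`-quotient as a function. [folklore] -/
theorem S252_apply : ∀ i, ∀ τ : ℍ, S252 i τ = etaQuotient 252 (expFn (PinningTwoFiftyTwo.Ls[(i : ℕ)]).1) τ :=
  (exists_etaCuspForms 252 PinningTwoFiftyTwo.Ls PinningTwoFiftyTwo.hcusp).choose_spec

/-- The `M₂`-images of `S252`. [folklore] -/
def C252 : Fin 37 → ModularForm (Gamma0 252) 2 := fun i ↦ ModularFormClass.modularForm (S252 i)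

/-- `C252 i` is the `i`-th `η`-quotient as a function. [folklore] -/
theorem C252_apply : ∀ i, ∀ τ : ℍ, C252 i τ = etaQuotient 252 (expFn (PinningTwoFiftyTwo.Ls[(i : ℕ)]).1) τ :=
  fun i τ ↦ S252_apply i τ

/-- **`tabs₂₅₂ j [n] = aₙ(C252 j)` for `n < 192`** (an g57's sparse certificates `PinningTwoFiftyTwo.hcert`). [cite: Koehler2011, §2.1] -/
theorem tabs252_eq_coeff : ∀ j, ∀ n < 192, (((PinningTwoFiftyTwo.tabs j).getD n 0 : ℤ) : ℂ) = modCoefₗ 252 2 n (C252 j) :=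
  tables_of_etaCertsSparse 252 192 (fun i : Fin 37 ↦ expFn (PinningTwoFiftyTwo.Ls[(i : ℕ)]).1) PinningTwoFiftyTwo.shifts PinningTwoFiftyTwo.tabs
    C252 C252_apply PinningTwoFiftyTwo.hshift PinningTwoFiftyTwo.hcert

/-- `μ(Γ₀(252)) = 576`. [cite: DiamondShurman2005, §3.8] -/
theorem gamma0Index_twoFiftyTwo : gamma0Index 252 = 576 := by
  rw [(gamma0Index_mul (m := 4) (n := 63) (by norm_num)), (gamma0Index_mul (m := 9) (n := 7) (by norm_num)),
    show (4 : ℕ) = 2 ^ 2 by norm_num, gamma0Index_prime_pow (p := 2) (e := 2) Nat.prime_two (by norm_num),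
    show (9 : ℕ) = 3 ^ 2 by norm_num, gamma0Index_prime_pow (p := 3) (e := 2) Nat.prime_three (by norm_num),
    gamma0Index_prime (by norm_num : Nat.Prime 7)]
  norm_num

/-! ## The class `84a` (optimal curve `84a1 = [0, 1, 0, 7, 0]`) -/

/-- **`Φ₈₄ₐ := (1/836)·Σ_j y_j·C_j ∈ M₂(Γ₀(84))`** — an's pinning row `rowA` of `84a` read as a DATUM-FREE modular form on
an's `η`-basis terms `C84`. [cite: CremonaAlgorithms1997, Table 3 (N = 84)] -/
def PhiA : ModularForm (Gamma0 84) 2 :=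
  ((rowA.2.1 : ℤ) : ℂ)⁻¹ • ∑ j : Fin 22, ((rowA.2.2.getD (j : ℕ) 0 : ℤ) : ℂ) • C84 j

/-- **`aₙ(Φ₈₄ₐ) = cFA[n] = aₙ(84a1)` for `n < 194`** (p2's row identity `hF_rowA` and the deep tables). [cite: CremonaAlgorithms1997, Table 3 (N = 84)] -/
theorem coeff_PhiA : ∀ n < 194, ((cFA.getD n 0 : ℤ) : ℂ) = (qExpansion 1 ⇑PhiA).coeff n := by
  intro n hn
  change _ = modCoefₗ 84 2 n PhiA
  rw [PhiA, map_smul, map_sum, smul_eq_mul]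
  simp only [map_smul, smul_eq_mul, modCoefₗ_apply]
  rw [Finset.sum_congr rfl fun j _ ↦ by rw [← tabsDeep_eq_coeff j n hn]]
  have h : ((rowA.2.1 : ℤ) : ℂ) * ((cFA.getD n 0 : ℤ) : ℂ) =
      ∑ j : Fin 22, ((rowA.2.2.getD (j : ℕ) 0 : ℤ) : ℂ) * (((tabsDeep j).getD n 0 : ℤ) : ℂ) := by
    exact_mod_cast hF_rowA n hn
  have hd : ((rowA.2.1 : ℤ) : ℂ) ≠ 0 := by norm_num [rowA]
  rw [← h, ← mul_assoc, inv_mul_cancel₀ hd, one_mul]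

/-- `Φ₈₄ₐ` viewed in `M₂(Γ₀(252))` (same function; `Γ₀(252) ≤ Γ₀(84)`). [cite: DiamondShurman2005, §5.6] -/
def PhiAL252 : ModularForm (Gamma0 252) 2 where
  toFun := PhiA
  slash_action_eq' γ hγ := SlashInvariantFormClass.slash_action_eq PhiA γ (Gamma0GL_le_of_dvd (⟨3, rfl⟩ : 84 ∣ 252) hγ)
  holo' := PhiA.holo'
  bdd_at_cusps' hc := PhiA.bdd_at_cusps' (hc.mono (Gamma0GL_le_of_dvd (⟨3, rfl⟩ : 84 ∣ 252)))

/-- `Φ₈₄ₐ|₂₅₂(τ) = Φ₈₄ₐ(τ)`. [folklore] -/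
theorem PhiAL252_apply (τ : ℍ) : PhiAL252 τ = PhiA τ := rfl

/-- Coordinates (doubled) of `Φ₈₄ₐ(τ)` on an's CUSPIDAL `η`-basis of `S₂(Γ₀(252))`: `2·Φ = Σ_j uA_j·S_j` (dual read-off `duals/1728`, exact). [folklore] -/
def uA : List ℤ := [0, 0, -3, -3, -2, -4, 7, 3, -4, 16, 3, 3, 4, 0, 0, 0, -2, 2, -6, 6, 3, -9, 0, 0, -3, -7, -3, -6, 4, -2, 0, 0, 0, 0, 6, 1, 0]

/-- The row identity behind the level-`252` Sturm comparison: `2·cFA[n] = Σ_j uA_j·tabs₂₅₂,j[n]` for `n < 97` (kernel `decide`). [folklore] -/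
theorem hrow_uA : ∀ n < 97, 2 * cFA.getD n 0 = ∑ j : Fin 37, uA.getD (j : ℕ) 0 * (PinningTwoFiftyTwo.tabs j).getD n 0 := by
  decide +kernel

/-- **`2·Φ₈₄ₐ = Σ_j uA_j·C₂₅₂,j` in `M₂(Γ₀(252))`** (Sturm at level `252`: `2·576/12 = 96 < 97` coefficients agree). [cite: Sturm1987, Thm. 1] -/
theorem two_smul_PhiAL252 : (2 : ℂ) • PhiAL252 = ∑ j : Fin 37, ((uA.getD (j : ℕ) 0 : ℤ) : ℂ) • C252 j := by
  rw [← sub_eq_zero]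
  refine modularForm_eq_zero_of_coeff_eq_zero _ (m := 97) (fun i hi ↦ ?_) (by rw [gamma0Index_twoFiftyTwo]; decide)
  change modCoefₗ 252 2 i _ = 0
  rw [map_sub, map_smul, map_sum, smul_eq_mul]
  simp only [map_smul, smul_eq_mul]
  have h1 : modCoefₗ 252 2 i PhiAL252 = ((cFA.getD i 0 : ℤ) : ℂ) := (coeff_PhiA i (by omega)).symm
  rw [h1, Finset.sum_congr rfl fun j _ ↦ by rw [← tabs252_eq_coeff j i (by omega)]]
  have h2 : (2 : ℂ) * ((cFA.getD i 0 : ℤ) : ℂ) =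
      ∑ j : Fin 37, ((uA.getD (j : ℕ) 0 : ℤ) : ℂ) * (((PinningTwoFiftyTwo.tabs j).getD i 0 : ℤ) : ℂ) := by
    exact_mod_cast hrow_uA i hi
  rw [h2, sub_self]

/-- `2·Φ₈₄ₐ` as a CUSP form of level `252`: `Σ_j uA_j·S_j`. [folklore] -/
def STwoA : CuspForm (Gamma0 252) 2 := ∑ j : Fin 37, ((uA.getD (j : ℕ) 0 : ℤ) : ℂ) • S252 j

/-- `(Σ_j uA_j·S_j)(τ) = 2·Φ₈₄ₐ(τ)`. [folklore] -/
theorem STwoA_apply (τ : ℍ) : STwoA τ = 2 * PhiA τ := by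
  have h := smul_modularForm_eq_sum STwoA S252 C252 (fun _ ↦ rfl) 1 (fun j ↦ ((uA.getD (j : ℕ) 0 : ℤ) : ℂ))
    (by rw [one_smul]; rfl)
  beta_reduce at h
  rw [one_smul, ← two_smul_PhiAL252] at h
  have hτ := congrArg (fun F : ModularForm (Gamma0 252) 2 ↦ F τ) h
  simp only [modularForm_apply, ModularForm.IsGLPos.smul_apply, smul_eq_mul, PhiAL252_apply] at hτ
  exact hτ

/-- **`φ₈₄ₐ ∈ S₂(Γ₀(84))` AS A TERM**: the function `Φ₈₄ₐ` (`Γ₀(84)`-modular) vanishes at every cusp because it is half the level-`252`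
cusp form `Σ_j uA_j·S_j` (every cusp of `Γ₀(84)` is a cusp of `Γ₀(252)`). [cite: DiamondShurman2005, §5.6] [cite: CremonaAlgorithms1997, Table 3 (N = 84)] -/
def phiEightyFourA : CuspForm (Gamma0 84) 2 where
  toFun := PhiA
  slash_action_eq' γ hγ := SlashInvariantFormClass.slash_action_eq PhiA γ hγ
  holo' := PhiA.holo'
  zero_at_cusps' {c} hc := by
    have hc252 : IsCusp c ((Gamma0 252 : Subgroup SL(2, ℤ)) : Subgroup (GL (Fin 2) ℝ)) := by
      rw [Subgroup.IsArithmetic.isCusp_iff_isCusp_SL2Z] at hc ⊢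
      exact hc
    have h := ((2 : ℂ)⁻¹ • STwoA).zero_at_cusps' hc252
    have hfun : ((2 : ℂ)⁻¹ • STwoA).toFun = ⇑PhiA := by
      funext τ
      change ((2 : ℂ)⁻¹ • STwoA) τ = PhiA τ
      rw [CuspForm.IsGLPos.smul_apply, smul_eq_mul, STwoA_apply, ← mul_assoc, inv_mul_cancel₀ (by norm_num : (2 : ℂ) ≠ 0),
        one_mul]
    rw [hfun] at h
    exact h

/-- The function of `φ₈₄ₐ` is `Φ₈₄ₐ`. [folklore] -/
theorem coe_phiEightyFourA : (⇑phiEightyFourA : ℍ → ℂ) = ⇑PhiA := rfl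

/-- **`aₙ(φ₈₄ₐ) = cFA[n] = aₙ(84a1)`, `n < 194`.** [cite: CremonaAlgorithms1997, Table 3 (N = 84)] -/
theorem tA_eq_cuspCoeff : ∀ n < 194, ((cFA.getD n 0 : ℤ) : ℂ) = cuspCoeff phiEightyFourA n :=
  coeff_PhiA

/-- `φ₈₄ₐ ≠ 0` (`a₁ = 1`). [folklore] -/
theorem phiEightyFourA_ne_zero : phiEightyFourA ≠ 0 := by
  intro h
  have h1 := tA_eq_cuspCoeff 1 (by norm_num)
  have ht : cFA.getD 1 0 = 1 := by decide
  rw [ht, h, show cuspCoeff (0 : CuspForm (Gamma0 84) 2) 1 = 0 from by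
    change (qExpansion 1 ⇑(0 : CuspForm (Gamma0 84) 2)).coeff 1 = 0
    rw [CuspForm.coe_zero, UpperHalfPlane.qExpansion_zero]; simp] at h1
  norm_num at h1

/-- `A = Σ_j alphaA_j·C_j ∈ M₂(Γ₀(84))` of p2's presentation `x∘φ = A/B` for `84a`, as a term. [folklore] -/
def formAA : ModularForm (Gamma0 84) 2 := ∑ j : Fin 22, ((alphaA.getD (j : ℕ) 0 : ℤ) : ℂ) • C84 j

/-- `B = Σ_j betaA_j·C_j ∈ M₂(Γ₀(84))` for `84a`, as a term. [folklore] -/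
def formBA : ModularForm (Gamma0 84) 2 := ∑ j : Fin 22, ((betaA.getD (j : ℕ) 0 : ℤ) : ℂ) • C84 j

/-- **`Λ(φ₈₄ₐ) ⊆ Λ(L₀)` for every Néron period pair `L₀` of `84a1 = [0, 1, 0, 7, 0]`** — p2's weight-12 Bracket–Sturm defect certificate of class `84a`
(`defectList_eq_eightyFourA`, depth `194`, Sturm `192 < 194`) re-instantiated on the datum-free terms. [cite: Sturm1987, Thm. 1] [cite: CremonaAlgorithms1997, §2.10, Table 1 (84a1)] -/
theorem periodLattice_le_phiEightyFourA (L₀ : PeriodPair) (hL₀ : IsNeronLatticeOf ((⟨0, 1, 0, 7, 0⟩ : WeierstrassCurve ℚ).baseChange ℂ) L₀) :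
    ∀ z ∈ periodLattice phiEightyFourA, z ∈ L₀.lattice := by
  obtain ⟨hc₂, hc₃⟩ := neron_invariants_eightyFourA1 hL₀
  have hA := qExpansion_coeff_sum_smul_eq_of_rows C84 tabsDeep tabsDeep_eq_coeff alphaA aTA hA_rowA
  have hB := qExpansion_coeff_sum_smul_eq_of_rows C84 tabsDeep tabsDeep_eq_coeff betaA bTA hB_rowA
  obtain ⟨h0, hBne, hCne⟩ := defectForm_coeff_eq_zero_of_defectList formAA formBA phiEightyFourA L₀.g₂ L₀.g₃ _ _ _ hA hB
    tA_eq_cuspCoeff 216 864 (-5760) (1952) (by norm_num) (by norm_num) hc₂ hc₃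
    (forall_getD_eq_zero_of_eq_replicate defectList_eq_eightyFourA) hBnz_eightyFourA hCnz_eightyFourA
  exact periodLattice_le_of_defectForm_eq_zero phiEightyFourA phiEightyFourA_ne_zero L₀ formAA formBA
    (modularForm_eq_zero_of_coeff_eq_zero _ h0 sturm_eightyFour) hBne hCne

/-! ## The class `84b` (optimal curve `84b1 = [0, -1, 0, -1, -2]`) -/

/-- **`Φ₈₄ᵦ := (1/1672)·Σ_j y_j·C_j ∈ M₂(Γ₀(84))`** — an's pinning row `rowB` of `84b` read as a DATUM-FREE modular form on
an's `η`-basis terms `C84`. [cite: CremonaAlgorithms1997, Table 3 (N = 84)] -/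
def PhiB : ModularForm (Gamma0 84) 2 :=
  ((rowB.2.1 : ℤ) : ℂ)⁻¹ • ∑ j : Fin 22, ((rowB.2.2.getD (j : ℕ) 0 : ℤ) : ℂ) • C84 j

/-- **`aₙ(Φ₈₄ᵦ) = cFB[n] = aₙ(84b1)` for `n < 194`** (p2's row identity `hF_rowB` and the deep tables). [cite: CremonaAlgorithms1997, Table 3 (N = 84)] -/
theorem coeff_PhiB : ∀ n < 194, ((cFB.getD n 0 : ℤ) : ℂ) = (qExpansion 1 ⇑PhiB).coeff n := by
  intro n hn
  change _ = modCoefₗ 84 2 n PhiB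
  rw [PhiB, map_smul, map_sum, smul_eq_mul]
  simp only [map_smul, smul_eq_mul, modCoefₗ_apply]
  rw [Finset.sum_congr rfl fun j _ ↦ by rw [← tabsDeep_eq_coeff j n hn]]
  have h : ((rowB.2.1 : ℤ) : ℂ) * ((cFB.getD n 0 : ℤ) : ℂ) =
      ∑ j : Fin 22, ((rowB.2.2.getD (j : ℕ) 0 : ℤ) : ℂ) * (((tabsDeep j).getD n 0 : ℤ) : ℂ) := by
    exact_mod_cast hF_rowB n hn
  have hd : ((rowB.2.1 : ℤ) : ℂ) ≠ 0 := by norm_num [rowB]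
  rw [← h, ← mul_assoc, inv_mul_cancel₀ hd, one_mul]

/-- `Φ₈₄ᵦ` viewed in `M₂(Γ₀(252))` (same function; `Γ₀(252) ≤ Γ₀(84)`). [cite: DiamondShurman2005, §5.6] -/
def PhiBL252 : ModularForm (Gamma0 252) 2 where
  toFun := PhiB
  slash_action_eq' γ hγ := SlashInvariantFormClass.slash_action_eq PhiB γ (Gamma0GL_le_of_dvd (⟨3, rfl⟩ : 84 ∣ 252) hγ)
  holo' := PhiB.holo'
  bdd_at_cusps' hc := PhiB.bdd_at_cusps' (hc.mono (Gamma0GL_le_of_dvd (⟨3, rfl⟩ : 84 ∣ 252)))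

/-- `Φ₈₄ᵦ|₂₅₂(τ) = Φ₈₄ᵦ(τ)`. [folklore] -/
theorem PhiBL252_apply (τ : ℍ) : PhiBL252 τ = PhiB τ := rfl

/-- Coordinates (doubled) of `Φ₈₄ᵦ(τ)` on an's CUSPIDAL `η`-basis of `S₂(Γ₀(252))`: `2·Φ = Σ_j uB_j·S_j` (dual read-off `duals/1728`, exact). [folklore] -/
def uB : List ℤ := [0, 0, 3, -3, -2, -4, 1, -1, -10, 16, -3, 3, 4, -24, 0, 0, -2, 2, -6, 6, 9, -9, 0, 0, -3, 21, 3, 6, 4, -2, 0, 0, 0, 0, -6, 1, 0]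

/-- The row identity behind the level-`252` Sturm comparison: `2·cFB[n] = Σ_j uB_j·tabs₂₅₂,j[n]` for `n < 97` (kernel `decide`). [folklore] -/
theorem hrow_uB : ∀ n < 97, 2 * cFB.getD n 0 = ∑ j : Fin 37, uB.getD (j : ℕ) 0 * (PinningTwoFiftyTwo.tabs j).getD n 0 := by
  decide +kernel

/-- **`2·Φ₈₄ᵦ = Σ_j uB_j·C₂₅₂,j` in `M₂(Γ₀(252))`** (Sturm at level `252`: `2·576/12 = 96 < 97` coefficients agree). [cite: Sturm1987, Thm. 1] -/
theorem two_smul_PhiBL252 : (2 : ℂ) • PhiBL252 = ∑ j : Fin 37, ((uB.getD (j : ℕ) 0 : ℤ) : ℂ) • C252 j := by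
  rw [← sub_eq_zero]
  refine modularForm_eq_zero_of_coeff_eq_zero _ (m := 97) (fun i hi ↦ ?_) (by rw [gamma0Index_twoFiftyTwo]; decide)
  change modCoefₗ 252 2 i _ = 0
  rw [map_sub, map_smul, map_sum, smul_eq_mul]
  simp only [map_smul, smul_eq_mul]
  have h1 : modCoefₗ 252 2 i PhiBL252 = ((cFB.getD i 0 : ℤ) : ℂ) := (coeff_PhiB i (by omega)).symm
  rw [h1, Finset.sum_congr rfl fun j _ ↦ by rw [← tabs252_eq_coeff j i (by omega)]]
  have h2 : (2 : ℂ) * ((cFB.getD i 0 : ℤ) : ℂ) =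
      ∑ j : Fin 37, ((uB.getD (j : ℕ) 0 : ℤ) : ℂ) * (((PinningTwoFiftyTwo.tabs j).getD i 0 : ℤ) : ℂ) := by
    exact_mod_cast hrow_uB i hi
  rw [h2, sub_self]

/-- `2·Φ₈₄ᵦ` as a CUSP form of level `252`: `Σ_j uB_j·S_j`. [folklore] -/
def STwoB : CuspForm (Gamma0 252) 2 := ∑ j : Fin 37, ((uB.getD (j : ℕ) 0 : ℤ) : ℂ) • S252 j

/-- `(Σ_j uB_j·S_j)(τ) = 2·Φ₈₄ᵦ(τ)`. [folklore] -/
theorem STwoB_apply (τ : ℍ) : STwoB τ = 2 * PhiB τ := by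
  have h := smul_modularForm_eq_sum STwoB S252 C252 (fun _ ↦ rfl) 1 (fun j ↦ ((uB.getD (j : ℕ) 0 : ℤ) : ℂ))
    (by rw [one_smul]; rfl)
  beta_reduce at h
  rw [one_smul, ← two_smul_PhiBL252] at h
  have hτ := congrArg (fun F : ModularForm (Gamma0 252) 2 ↦ F τ) h
  simp only [modularForm_apply, ModularForm.IsGLPos.smul_apply, smul_eq_mul, PhiBL252_apply] at hτ
  exact hτ

/-- **`φ₈₄ᵦ ∈ S₂(Γ₀(84))` AS A TERM**: the function `Φ₈₄ᵦ` (`Γ₀(84)`-modular) vanishes at every cusp because it is half the level-`252`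
cusp form `Σ_j uB_j·S_j` (every cusp of `Γ₀(84)` is a cusp of `Γ₀(252)`). [cite: DiamondShurman2005, §5.6] [cite: CremonaAlgorithms1997, Table 3 (N = 84)] -/
def phiEightyFourB : CuspForm (Gamma0 84) 2 where
  toFun := PhiB
  slash_action_eq' γ hγ := SlashInvariantFormClass.slash_action_eq PhiB γ hγ
  holo' := PhiB.holo'
  zero_at_cusps' {c} hc := by
    have hc252 : IsCusp c ((Gamma0 252 : Subgroup SL(2, ℤ)) : Subgroup (GL (Fin 2) ℝ)) := by
      rw [Subgroup.IsArithmetic.isCusp_iff_isCusp_SL2Z] at hc ⊢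
      exact hc
    have h := ((2 : ℂ)⁻¹ • STwoB).zero_at_cusps' hc252
    have hfun : ((2 : ℂ)⁻¹ • STwoB).toFun = ⇑PhiB := by
      funext τ
      change ((2 : ℂ)⁻¹ • STwoB) τ = PhiB τ
      rw [CuspForm.IsGLPos.smul_apply, smul_eq_mul, STwoB_apply, ← mul_assoc, inv_mul_cancel₀ (by norm_num : (2 : ℂ) ≠ 0),
        one_mul]
    rw [hfun] at h
    exact h

/-- The function of `φ₈₄ᵦ` is `Φ₈₄ᵦ`. [folklore] -/
theorem coe_phiEightyFourB : (⇑phiEightyFourB : ℍ → ℂ) = ⇑PhiB := rfl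

/-- **`aₙ(φ₈₄ᵦ) = cFB[n] = aₙ(84b1)`, `n < 194`.** [cite: CremonaAlgorithms1997, Table 3 (N = 84)] -/
theorem tB_eq_cuspCoeff : ∀ n < 194, ((cFB.getD n 0 : ℤ) : ℂ) = cuspCoeff phiEightyFourB n :=
  coeff_PhiB

/-- `φ₈₄ᵦ ≠ 0` (`a₁ = 1`). [folklore] -/
theorem phiEightyFourB_ne_zero : phiEightyFourB ≠ 0 := by
  intro h
  have h1 := tB_eq_cuspCoeff 1 (by norm_num)
  have ht : cFB.getD 1 0 = 1 := by decide
  rw [ht, h, show cuspCoeff (0 : CuspForm (Gamma0 84) 2) 1 = 0 from by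
    change (qExpansion 1 ⇑(0 : CuspForm (Gamma0 84) 2)).coeff 1 = 0
    rw [CuspForm.coe_zero, UpperHalfPlane.qExpansion_zero]; simp] at h1
  norm_num at h1

/-- `A = Σ_j alphaB_j·C_j ∈ M₂(Γ₀(84))` of p2's presentation `x∘φ = A/B` for `84b`, as a term. [folklore] -/
def formAB : ModularForm (Gamma0 84) 2 := ∑ j : Fin 22, ((alphaB.getD (j : ℕ) 0 : ℤ) : ℂ) • C84 j

/-- `B = Σ_j betaB_j·C_j ∈ M₂(Γ₀(84))` for `84b`, as a term. [folklore] -/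
def formBB : ModularForm (Gamma0 84) 2 := ∑ j : Fin 22, ((betaB.getD (j : ℕ) 0 : ℤ) : ℂ) • C84 j

/-- **`Λ(φ₈₄ᵦ) ⊆ Λ(L₀)` for every Néron period pair `L₀` of `84b1 = [0, -1, 0, -1, -2]`** — p2's weight-12 Bracket–Sturm defect certificate of class `84b`
(`defectList_eq_eightyFourB`, depth `194`, Sturm `192 < 194`) re-instantiated on the datum-free terms. [cite: Sturm1987, Thm. 1] [cite: CremonaAlgorithms1997, §2.10, Table 1 (84b1)] -/
theorem periodLattice_le_phiEightyFourB (L₀ : PeriodPair) (hL₀ : IsNeronLatticeOf ((⟨0, -1, 0, -1, -2⟩ : WeierstrassCurve ℚ).baseChange ℂ) L₀) :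
    ∀ z ∈ periodLattice phiEightyFourB, z ∈ L₀.lattice := by
  obtain ⟨hc₂, hc₃⟩ := neron_invariants_eightyFourB1 hL₀
  have hA := qExpansion_coeff_sum_smul_eq_of_rows C84 tabsDeep tabsDeep_eq_coeff alphaB aTB hA_rowB
  have hB := qExpansion_coeff_sum_smul_eq_of_rows C84 tabsDeep tabsDeep_eq_coeff betaB bTB hB_rowB
  obtain ⟨h0, hBne, hCne⟩ := defectForm_coeff_eq_zero_of_defectList formAB formBB phiEightyFourB L₀.g₂ L₀.g₃ _ _ _ hA hB
    tB_eq_cuspCoeff 216 864 (1152) (2080) (by norm_num) (by norm_num) hc₂ hc₃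
    (forall_getD_eq_zero_of_eq_replicate defectList_eq_eightyFourB) hBnz_eightyFourB hCnz_eightyFourB
  exact periodLattice_le_of_defectForm_eq_zero phiEightyFourB phiEightyFourB_ne_zero L₀ formAB formBB
    (modularForm_eq_zero_of_coeff_eq_zero _ h0 sturm_eightyFour) hBne hCne

end Summit.BirchSwinnertonDyer.BirchSwinnertonDyer.Theorems.ManinLocalTwoThree.RootFormsEightyFour

end
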